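import Summits.QuantumFields.YangMills.Theorems.UnitScaleTiltProp7FirstVariationExactPairing
import Summits.QuantumFields.YangMills.Theorems.UnitScaleTiltProp8HalvingDressedCriticality
import Literature.MathematicalPhysics.QuantumFieldTheory.AdmissiblePlaquetteWeightProofs
import Mathlib.Analysis.Convex.Cone.Extension
import Mathlib.Analysis.RCLike.Extend
import HarnessLib

/-!
# Route `UnitScaleTilt`, crux K1 «MinimiserStabilityRegPr» (stmt-QuantumFields-19200), route-R row (δ′) (★★OWNER g27 ACK 58 (2), 2026-08-28) —
# THE MULTIPLIER'S SIZE AND ITS RIESZ REPRESENTATIVE: `|Λ Z| ≤ 2ε₀ℓ⁻¹·‖Z‖₁` ON ALL COARSE BOND FIELDS, `Λ Z = Σ_c Re tr(λ(c)·Z(c))`, `‖λ(c)‖ ≤ 2ε₀ℓ⁻¹`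

Cell `ym3-torus`, keyed width hand `ym-routeR-w2` (gen 2).  THEOREMS ONLY (0 `def`, 0 `sorry`); `--supports stmt-QuantumFields-19200`, count-neutral.  YM₃ on T³ is a ladder
rung (R3), not the Clay problem; nothing here claims a stub, the crux, d = 4 or the mass gap.

WHY (route-R card `Lines/birth_routeR.md` §2(c) «at the top `|Λ_c| ≲ ε₀L^{−(K−n)}`», §4 S-layer (iii); ★w4-19200 g4's JOINT-ROW road `Lin_W = ⟨λ, Q_W ·⟩`, `‖λ‖_∞ ≲ e·ℓ⁻¹`).
FILE 2 of (R-δ) (`Prop7FirstVariationExactPairing.exists_multiplier_functional`, ✓p633748) produces the Lagrange multiplier of the (0.4)-constraint at an R2-critical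
`U₀ ∈ (6)(ε₀)` as a real-linear FUNCTIONAL `Λ` on the level-`(K−n)` bond fields with the exact pairing `Lin_{U₀} = Λ ∘ Q (K−n)` on `𝔰𝔲(2)`-valued directions and the
Lagrange orthogonality to coarse pure gauges — but the functional there is an ARBITRARY linear extension off `range Q (K−n)|_{𝔰𝔲(2)}`, so it carries no size, and its
Riesz representative is not spelled out (HONEST SCOPE of that file).  Here the extension is chosen by HAHN–BANACH under the sublinear majorant
`N(Z) = 2ε₀L^{−(K−n)}·Σ_c‖Z(c)‖` furnished by `abs_lin_le_sum_norm_trueLinIter` (§1 of that file), so that the multiplier is bounded in `ℓ¹`-duality on ALL coarse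
bond fields — the top-level multiplier size of the route-R card, in the tree's `Q`-currency — and its Riesz representative `λ` for the trace pairing
`⟨λ, Z⟩ = Σ_c Re tr(λ(c)Z(c))` obeys `‖λ(c)‖ ≤ 2ε₀L^{−(K−n)}` at EVERY coarse bond (operator norm).  USE: for a direction `A` whose constraint velocity splits as
`Q (K−n) A = (coarse pure gauge) + r`, (i)+(ii)+(iii) give `|Lin_{U₀}(A)| = |Λ r| ≤ 2ε₀L^{−(K−n)}·‖r‖₁` with NO right inverse of `Q` (one power of `ℓ = L^{K−n}` weaker
than the (46)-`H` route of print, which would read `‖J‖_∞·‖H‖_{1→1} = O(ε₀ℓ⁻²)` per unit `ℓ¹`-mass — honest).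

WHAT IS PROVED (ns `…Theorems.Prop7FirstVariationMultiplierBound`).
* §1 (linear algebra, any real vector spaces) `exists_factor_le_sublinear` — a functional `L` dominated by a sublinear `N ∘ T` FACTORS through `T` with a factor
  dominated by `N` (quotient-by-kernel + Hahn–Banach `exists_extension_of_le_sublinear`); `exists_factor_abs_le` — the symmetric form `|Λ z| ≤ N z`.
* §2 (matrix fields, any finite index type) `exists_re_trace_pairing` — Riesz for REAL-linear functionals: `Λ Z = Σ_c Re tr(λ(c)Z(c))` (complexification
  `Module.Dual.extendRCLike` + the tree's ℂ-linear `HalvingDressedCriticality.trace_pairing_riesz`); `norm_le_of_abs_sum_re_trace_mul_le` — an `ℓ¹`-duality bound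
  `|Σ_c Re tr(λ(c)Z(c))| ≤ C·Σ_c‖Z(c)‖` forces `‖λ(c)‖ ≤ C` (test field `Z = δ_c·λ(c)ᴴ`, `‖λ‖² ≤ Σ|λᵢⱼ|² = Re tr(λᴴλ)`).
* §3 (T³, SU(2), EXACTLY the binders of ✓`exists_multiplier_functional`) ★★ `exists_multiplier_functional_bounded` — (i) exact pairing, (ii) `Λ ⊥` coarse pure gauges,
  (iii) `∀ Z, |Λ Z| ≤ 2ε₀(L^{K−n})⁻¹·Σ_c‖Z c‖`; ★ `exists_multiplier_field` — the same three clauses for the representative `λ` plus (iv) `∀ c, ‖λ c‖ ≤ 2ε₀(L^{K−n})⁻¹`.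

HONEST SCOPE.  Functional analysis over landed theorems; the constant `2ε₀L^{−(K−n)}` is that of `Prop7FirstVariationMultiplier.abs_lin_le_constraint_velocity`
(`‖J‖_∞·‖R_tree‖_{1→1}`), not print's sharper multiplier size; the R2-criticality binder `IsCritR2` is that of the route-R stubs (the stationarity-currency twin for the
EX knit's `hEL` clause is NOT here); nothing of Bałaban's analysis is asserted.

References: T. Bałaban, CMP 102 (1985) 277–309 [Balaban1985Variational] ((2), (6) p.278, (45)–(48) pp.285–287, (141)–(143) p.299); CMP 99 (1985) 389–434
[Balaban1985BackgroundPropagators] ((3.9)–(3.11) p.392); CMP 98 (1985) 17–51 [Balaban1985Averaging] ((11) p.19).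
-/

set_option autoImplicit false

noncomputable section

open scoped BigOperators Matrix.Norms.L2Operator Matrix Topology

namespace Summit.QuantumFields.YangMills.Theorems.Prop7FirstVariationMultiplierBound

open Filter NormedSpace
open Literature.MathematicalPhysics.QuantumFieldTheory
open Literature.MathematicalPhysics.QuantumFieldTheory.Balaban1983to89
open Literature.MathematicalPhysics.QuantumFieldTheory.Balaban1983to89.T3ContinuumYM3Torus
open T4Continuum BlockAveraging AveragingRT ExpMeanLog BlockAveragingEMLLinearised BlockAveragingEMLLinearisedBackground BlockAveragingEMLProp2
open T3RegularMinimiser T3PrintedRegularMinimiser T3Thm1CarrierNative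
open B15DeterminingSets (embIter)
open B10Eq27TorusAxialLog (unitsField toUField)
open B10Eq68TorusRegularity (covDivT)
open Summit.QuantumFields.YangMills.Theorems.Prop7FirstVariationExactPairing
  (tower_loop_rows_of_regPr abs_lin_le_sum_norm_trueLinIter gaugeDir_mem_su2)
open Summit.QuantumFields.YangMills.Theorems.HalvingDressedCriticality (trace_pairing_riesz)

/-! ## §1 Linear algebra: factoring a dominated functional through a linear map, with a dominated factor -/

/-- **FACTORING UNDER A SUBLINEAR MAJORANT.**  If a real-linear functional `L` on `E` is dominated by `N ∘ T` for a linear `T : E → G` and a sublinear `N` on `G`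
(positively homogeneous, subadditive), then `L = Λ ∘ T` for a real-linear `Λ` on `G` with `Λ ≤ N` everywhere: `L` vanishes on `ker T` (`N 0 = 0`), so it factors through
`range T` (first isomorphism theorem), where the factor is dominated by `N`; extend by Hahn–Banach (`exists_extension_of_le_sublinear`). [folklore] -/
theorem exists_factor_le_sublinear {E G : Type*} [AddCommGroup E] [Module ℝ E] [AddCommGroup G] [Module ℝ G]
    (L : E →ₗ[ℝ] ℝ) (T : E →ₗ[ℝ] G) (N : G → ℝ)
    (N_hom : ∀ c : ℝ, 0 < c → ∀ x, N (c • x) = c * N x) (N_add : ∀ x y, N (x + y) ≤ N x + N y)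
    (hL : ∀ x, L x ≤ N (T x)) :
    ∃ Λ : G →ₗ[ℝ] ℝ, (∀ x, L x = Λ (T x)) ∧ ∀ z, Λ z ≤ N z := by
  have N0 : N 0 = 0 := by
    have h := N_hom 2 (by norm_num) 0
    rw [smul_zero] at h
    linarith
  -- `ker T ≤ ker L`
  have hker : LinearMap.ker T ≤ LinearMap.ker L := by
    intro x hx
    rw [LinearMap.mem_ker] at hx ⊢
    have h1 := hL x
    have h2 := hL (-x)
    rw [hx, N0] at h1
    rw [map_neg, map_neg, hx, neg_zero, N0] at h2
    linarith
  -- the factor through the range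
  let g : LinearMap.range T →ₗ[ℝ] ℝ := ((LinearMap.ker T).liftQ L hker) ∘ₗ T.quotKerEquivRange.symm.toLinearMap
  have hg : ∀ x, g ⟨T x, LinearMap.mem_range_self T x⟩ = L x := by
    intro x
    have e2 : T.quotKerEquivRange.symm ⟨T x, LinearMap.mem_range_self T x⟩ = Submodule.Quotient.mk x := by
      rw [LinearEquiv.symm_apply_eq]
      apply Subtype.ext
      exact (LinearMap.quotKerEquivRange_apply_mk T x).symm
    show ((LinearMap.ker T).liftQ L hker) (T.quotKerEquivRange.symm ⟨T x, LinearMap.mem_range_self T x⟩) = L x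
    rw [e2, Submodule.liftQ_apply]
  let f : G →ₗ.[ℝ] ℝ := ⟨LinearMap.range T, g⟩
  have hf : ∀ z : f.domain, f z ≤ N z := by
    rintro ⟨z, hz⟩
    obtain ⟨x, rfl⟩ := LinearMap.mem_range.mp hz
    show g ⟨T x, LinearMap.mem_range_self T x⟩ ≤ N (T x)
    rw [hg]
    exact hL x
  obtain ⟨Λ, hΛf, hΛN⟩ := exists_extension_of_le_sublinear f N N_hom N_add hf
  refine ⟨Λ, fun x => ?_, hΛN⟩
  have h := hΛf ⟨T x, LinearMap.mem_range_self T x⟩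
  rw [← hg x]
  exact h.symm

/-- The symmetric form: if moreover `N (−z) = N z`, the factor satisfies `|Λ z| ≤ N z`. [folklore] -/
theorem exists_factor_abs_le {E G : Type*} [AddCommGroup E] [Module ℝ E] [AddCommGroup G] [Module ℝ G]
    (L : E →ₗ[ℝ] ℝ) (T : E →ₗ[ℝ] G) (N : G → ℝ)
    (N_hom : ∀ c : ℝ, 0 < c → ∀ x, N (c • x) = c * N x) (N_add : ∀ x y, N (x + y) ≤ N x + N y) (N_neg : ∀ x, N (-x) = N x)
    (hL : ∀ x, |L x| ≤ N (T x)) :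
    ∃ Λ : G →ₗ[ℝ] ℝ, (∀ x, L x = Λ (T x)) ∧ ∀ z, |Λ z| ≤ N z := by
  obtain ⟨Λ, hΛ, hN⟩ := exists_factor_le_sublinear L T N N_hom N_add fun x => (le_abs_self _).trans (hL x)
  refine ⟨Λ, hΛ, fun z => abs_le.mpr ⟨?_, hN z⟩⟩
  have h := hN (-z)
  rw [map_neg, N_neg] at h
  linarith

/-! ## §2 Riesz for real-linear functionals on matrix fields, and the pointwise size -/

section Riesz

variable {ι : Type*} [Fintype ι] [DecidableEq ι] {N : ℕ}

/-- **RIESZ FOR THE REAL TRACE PAIRING**: a real-linear functional `Λ` on `M_N(ℂ)`-valued fields is `Z ↦ Σ_c Re tr(λ(c)·Z(c))` for the field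
`λ(c) = (Λ^ℂ(e_{c,(j,i)}))_{(i,j)}`, `Λ^ℂ = Λ − iΛ(i·)` the ℂ-linear functional with real part `Λ` (`Module.Dual.extendRCLike`; then the tree's ℂ-linear Riesz
`HalvingDressedCriticality.trace_pairing_riesz`). [cite: Balaban1985Variational, (5) p.278, (27) p.282] -/
theorem exists_re_trace_pairing (Λ : (ι → Matrix (Fin N) (Fin N) ℂ) →ₗ[ℝ] ℝ) :
    ∃ lam : ι → Matrix (Fin N) (Fin N) ℂ, ∀ Z : ι → Matrix (Fin N) (Fin N) ℂ, Λ Z = ∑ c, ((lam c * Z c).trace).re := by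
  refine ⟨fun c => Matrix.of fun i j => (Module.Dual.extendRCLike (𝕜 := ℂ) Λ) (Pi.single c (Matrix.single j i (1 : ℂ))), fun Z => ?_⟩
  have h := trace_pairing_riesz (Module.Dual.extendRCLike (𝕜 := ℂ) Λ) Z
  have h2 := congrArg Complex.re h
  rw [Complex.re_sum] at h2
  rw [h2]
  have h3 := Module.Dual.re_extendRCLike_apply (𝕜 := ℂ) Λ Z
  rw [RCLike.re_to_complex] at h3
  exact h3.symm

/-- **THE `ℓ¹`-DUAL SIZE IS THE POINTWISE OPERATOR-NORM SIZE**: if `|Σ_c Re tr(λ(c)Z(c))| ≤ C·Σ_c‖Z(c)‖` for every field `Z`, then `‖λ(c)‖ ≤ C` at every `c`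
(test field `Z = δ_c·λ(c)ᴴ`: `Re tr(λλᴴ) = Σ|λᵢⱼ|² ≥ ‖λ‖²` by `l2_opNorm_sq_le_sum_norm_sq`, `‖λᴴ‖ = ‖λ‖`). [folklore] -/
theorem norm_le_of_abs_sum_re_trace_mul_le (lam : ι → Matrix (Fin N) (Fin N) ℂ) {C : ℝ} (hC : 0 ≤ C)
    (h : ∀ Z : ι → Matrix (Fin N) (Fin N) ℂ, |∑ c, ((lam c * Z c).trace).re| ≤ C * ∑ c, ‖Z c‖) (c : ι) :
    ‖lam c‖ ≤ C := by
  have h1 := h (Pi.single c (lam c)ᴴ)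
  have hsum : ∑ c', ((lam c' * (Pi.single c (lam c)ᴴ : ι → Matrix (Fin N) (Fin N) ℂ) c').trace).re = ((lam c)ᴴ * lam c).trace.re := by
    rw [Finset.sum_eq_single c]
    · rw [Pi.single_eq_same, Matrix.trace_mul_comm]
    · intro c' _ hc'
      rw [Pi.single_eq_of_ne hc', Matrix.mul_zero, Matrix.trace_zero, Complex.zero_re]
    · intro hc; exact absurd (Finset.mem_univ c) hc
  have hnorm : ∑ c', ‖(Pi.single c (lam c)ᴴ : ι → Matrix (Fin N) (Fin N) ℂ) c'‖ = ‖lam c‖ := by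
    rw [Finset.sum_eq_single c]
    · rw [Pi.single_eq_same, Matrix.l2_opNorm_conjTranspose]
    · intro c' _ hc'
      rw [Pi.single_eq_of_ne hc', norm_zero]
    · intro hc; exact absurd (Finset.mem_univ c) hc
  rw [hsum, hnorm, ← sum_norm_sq_eq_re_trace_conjTranspose_mul_self] at h1
  have h2 : ‖lam c‖ ^ 2 ≤ C * ‖lam c‖ :=
    (l2_opNorm_sq_le_sum_norm_sq (lam c)).trans ((le_abs_self _).trans h1)
  by_cases h0 : ‖lam c‖ = 0
  · rw [h0]; exact hC
  · have hpos : 0 < ‖lam c‖ := lt_of_le_of_ne (norm_nonneg _) (Ne.symm h0)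
    rw [pow_two] at h2
    exact le_of_mul_le_mul_right h2 hpos

end Riesz

/-! ## §3 The bounded multiplier at an R2-critical configuration (T³, SU(2)) -/

variable (F : T3Family) {n K : ℕ}

/-- ★★ **THE BOUNDED MULTIPLIER THEOREM.**  For an R2-critical `U₀ ∈ (6)(ε₀)` (`10¹⁰L⁶ε₀ ≤ 1`) and every recursion family `Q` of the true one-step linearisations
along its tower there is a real-linear functional `Λ` on the level-`(K−n)` bond fields with
(i) `Lin_{U₀}(A) = Λ (Q (K−n) A)` for EVERY `𝔰𝔲(2)`-valued bond field `A` (exact pairing),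
(ii) `Λ (c ↦ ξ(embIter c₋) − V_c·ξ(embIter c₊)·V_c*) = 0` for every `𝔰𝔲(2)`-valued site field `ξ`, `V = Ū₀^{(K−n)}` (orthogonality to coarse pure gauges), AND
(iii) `|Λ Z| ≤ 2ε₀(L^{K−n})⁻¹·Σ_c‖Z c‖` for EVERY coarse bond field `Z` (the multiplier's `ℓ¹`-dual size = the card's top-level `|Λ_c| ≲ ε₀L^{−(K−n)}`): §1 applied to
`Lin_{U₀}` on the real space of `𝔰𝔲(2)`-valued fields, `Q (K−n)`, and the majorant of `Prop7FirstVariationExactPairing.abs_lin_le_sum_norm_trueLinIter`; (ii) as in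
`exists_multiplier_functional` (`trueLinIter_pureGauge` + `lin_gaugeDir_eq_zero`).
[cite: Balaban1985Variational, (141)-(143) p.299, (45)-(48) pp.285-287; Balaban1985BackgroundPropagators, (3.9)-(3.11) p.392; Balaban1985Averaging, (11) p.19] -/
theorem exists_multiplier_functional_bounded (hnK : n ≤ K)
    {V : GaugeField (F.P n) 0 (Matrix.specialUnitaryGroup (Fin 2) ℂ)} {U₀ : GaugeField (F.P K) 0 (Matrix.specialUnitaryGroup (Fin 2) ℂ)}
    (hcrit : IsCritR2 F n K hnK V U₀) {ε₀ : ℝ} (hε₀ : 0 < ε₀) (hε : 10 ^ 10 * (F.L : ℝ) ^ 6 * ε₀ ≤ 1) (hU₀reg : RegPr F n K ε₀ U₀)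
    (Q : (k : ℕ) → (PBond (F.P K) 0 → Matrix (Fin 2) (Fin 2) ℂ) → PBond (F.P K) k → Matrix (Fin 2) (Fin 2) ℂ) (hQ0 : ∀ Y, Q 0 Y = Y)
    (hQs : ∀ (k : ℕ) (Y : PBond (F.P K) 0 → Matrix (Fin 2) (Fin 2) ℂ) (c : PBond (F.P K) (k + 1)), Q (k + 1) Y c
      = fderiv ℂ (eml : (Idx (F.P K) → Matrix (Fin 2) (Fin 2) ℂ) → Matrix (Fin 2) (Fin 2) ℂ)
            (fun i => ((loopHol (Averaging.iter (fun i => blockAvg (P := F.P K) (j := i) (expMeanLogSU (n := Fin 2))) k U₀) c i :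
              Matrix.specialUnitaryGroup (Fin 2) ℂ) : Matrix (Fin 2) (Fin 2) ℂ))
            (fun i => covWalkSum (Averaging.iter (fun i => blockAvg (P := F.P K) (j := i) (expMeanLogSU (n := Fin 2))) k U₀) (Q k Y)
                (walk (emb c.src) (loopWord (F.P K).L c.dir (off i.1) i.2.1 i.2.2))
              * ((loopHol (Averaging.iter (fun i => blockAvg (P := F.P K) (j := i) (expMeanLogSU (n := Fin 2))) k U₀) c i :
                Matrix.specialUnitaryGroup (Fin 2) ℂ) : Matrix (Fin 2) (Fin 2) ℂ))
            * star ((corr (expMeanLogSU (n := Fin 2)) (Averaging.iter (fun i => blockAvg (P := F.P K) (j := i) (expMeanLogSU (n := Fin 2))) k U₀) c :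
                Matrix.specialUnitaryGroup (Fin 2) ℂ) : Matrix (Fin 2) (Fin 2) ℂ)
          + ((corr (expMeanLogSU (n := Fin 2)) (Averaging.iter (fun i => blockAvg (P := F.P K) (j := i) (expMeanLogSU (n := Fin 2))) k U₀) c :
                Matrix.specialUnitaryGroup (Fin 2) ℂ) : Matrix (Fin 2) (Fin 2) ℂ)
            * covWalkSum (Averaging.iter (fun i => blockAvg (P := F.P K) (j := i) (expMeanLogSU (n := Fin 2))) k U₀) (Q k Y)
                (walk (emb c.src) (List.replicate (F.P K).L (c.dir, true)))
            * star ((corr (expMeanLogSU (n := Fin 2)) (Averaging.iter (fun i => blockAvg (P := F.P K) (j := i) (expMeanLogSU (n := Fin 2))) k U₀) c :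
                Matrix.specialUnitaryGroup (Fin 2) ℂ) : Matrix (Fin 2) (Fin 2) ℂ)) :
    ∃ Λ : (PBond (F.P K) (K - n) → Matrix (Fin 2) (Fin 2) ℂ) →ₗ[ℝ] ℝ,
      (∀ A : PBond (F.P K) 0 → Matrix (Fin 2) (Fin 2) ℂ, (∀ b, A b ∈ skewAdjoint (Matrix (Fin 2) (Fin 2) ℂ)) → (∀ b, (A b).trace = 0) →
        ∑ p : Plaq (F.P K) 0, (1 / 2) * ((((((GaugeField.plaqHol U₀ p : Matrix.specialUnitaryGroup (Fin 2) ℂ) : Matrix (Fin 2) (Fin 2) ℂ)) - 1)ᴴ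
          * ((A ⟨p.src, p.μ⟩
              + (U₀ ⟨p.src, p.μ⟩ : Matrix (Fin 2) (Fin 2) ℂ) * A ⟨p.src.shift p.μ, p.ν⟩ * star (U₀ ⟨p.src, p.μ⟩ : Matrix (Fin 2) (Fin 2) ℂ)
              - ((U₀ ⟨p.src, p.μ⟩ * U₀ ⟨p.src.shift p.μ, p.ν⟩ * (U₀ ⟨p.src.shift p.ν, p.μ⟩)⁻¹ : Matrix.specialUnitaryGroup (Fin 2) ℂ) : Matrix (Fin 2) (Fin 2) ℂ)
                  * A ⟨p.src.shift p.ν, p.μ⟩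
                  * star ((U₀ ⟨p.src, p.μ⟩ * U₀ ⟨p.src.shift p.μ, p.ν⟩ * (U₀ ⟨p.src.shift p.ν, p.μ⟩)⁻¹ : Matrix.specialUnitaryGroup (Fin 2) ℂ) : Matrix (Fin 2) (Fin 2) ℂ)
              - ((GaugeField.plaqHol U₀ p : Matrix.specialUnitaryGroup (Fin 2) ℂ) : Matrix (Fin 2) (Fin 2) ℂ) * A ⟨p.src, p.ν⟩
                  * star ((GaugeField.plaqHol U₀ p : Matrix.specialUnitaryGroup (Fin 2) ℂ) : Matrix (Fin 2) (Fin 2) ℂ))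
            * ((GaugeField.plaqHol U₀ p : Matrix.specialUnitaryGroup (Fin 2) ℂ) : Matrix (Fin 2) (Fin 2) ℂ))).trace).re = Λ (Q (K - n) A)) ∧
      (∀ ξ : Site (F.P K) 0 → Matrix (Fin 2) (Fin 2) ℂ, (∀ x, ξ x ∈ skewAdjoint (Matrix (Fin 2) (Fin 2) ℂ)) → (∀ x, (ξ x).trace = 0) →
        Λ (fun c : PBond (F.P K) (K - n) => ξ (embIter (K - n) c.src)
          - ((Averaging.iter (fun i => blockAvg (P := F.P K) (j := i) (expMeanLogSU (n := Fin 2))) (K - n) U₀ c : Matrix.specialUnitaryGroup (Fin 2) ℂ) :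
              Matrix (Fin 2) (Fin 2) ℂ) * ξ (embIter (K - n) c.tgt)
            * star ((Averaging.iter (fun i => blockAvg (P := F.P K) (j := i) (expMeanLogSU (n := Fin 2))) (K - n) U₀ c : Matrix.specialUnitaryGroup (Fin 2) ℂ) :
              Matrix (Fin 2) (Fin 2) ℂ)) = 0) ∧
      (∀ Z : PBond (F.P K) (K - n) → Matrix (Fin 2) (Fin 2) ℂ, |Λ Z| ≤ 2 * ε₀ * ((F.L : ℝ) ^ (K - n))⁻¹ * ∑ c, ‖Z c‖) := by
  classical
  -- the real subspace of `𝔰𝔲(2)`-valued bond fields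
  let S : Submodule ℝ (PBond (F.P K) 0 → Matrix (Fin 2) (Fin 2) ℂ) :=
    { carrier := {A | ∀ b, A b ∈ skewAdjoint (Matrix (Fin 2) (Fin 2) ℂ) ∧ (A b).trace = 0}
      add_mem' := fun {A B} hA hB b => ⟨by rw [Pi.add_apply]; exact (skewAdjoint _).add_mem (hA b).1 (hB b).1,
        by rw [Pi.add_apply, Matrix.trace_add, (hA b).2, (hB b).2, add_zero]⟩
      zero_mem' := fun b => ⟨by rw [Pi.zero_apply]; exact (skewAdjoint _).zero_mem, by rw [Pi.zero_apply, Matrix.trace_zero]⟩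
      smul_mem' := fun r A hA b => ⟨by rw [Pi.smul_apply]; exact skewAdjoint.smul_mem r (hA b).1,
        by rw [Pi.smul_apply, Matrix.trace_smul, (hA b).2, smul_zero]⟩ }
  -- `Lin_{U₀}` as a real-linear functional on `S` (via the current pairing)
  let L : S →ₗ[ℝ] ℝ :=
    { toFun := fun A => -(1 / 2) * ∑ b : PBond (F.P K) 0, ((A.1 b * covDivT 1 (unitsField (toUField U₀)) b.dir b.src).trace).re
      map_add' := fun A B => by
        simp only [Submodule.coe_add, Pi.add_apply, Matrix.add_mul, Matrix.trace_add, Complex.add_re, Finset.sum_add_distrib]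
        ring
      map_smul' := fun r A => by
        simp only [Submodule.coe_smul, Pi.smul_apply, Matrix.smul_mul, Matrix.trace_smul, Complex.smul_re, ← Finset.mul_sum,
          RingHom.id_apply, smul_eq_mul]
        ring }
  -- `Q (K−n)` as a real-linear map on `S`
  let T : S →ₗ[ℝ] (PBond (F.P K) (K - n) → Matrix (Fin 2) (Fin 2) ℂ) :=
    { toFun := fun A => Q (K - n) A.1
      map_add' := fun A B => by
        funext c
        rw [Submodule.coe_add, Pi.add_apply]
        exact Prop7TrueLinPureGaugeIter.trueLinIter_add U₀ Q hQ0 hQs (K - n) A.1 B.1 c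
      map_smul' := fun r A => by
        funext c
        have e1 : ((r • A : S) : PBond (F.P K) 0 → Matrix (Fin 2) (Fin 2) ℂ) = (r : ℂ) • (A.1 : PBond (F.P K) 0 → Matrix (Fin 2) (Fin 2) ℂ) := by
          rw [Submodule.coe_smul]; exact RCLike.real_smul_eq_coe_smul (K := ℂ) r _
        rw [e1, RingHom.id_apply, Pi.smul_apply, Prop7TrueLinPureGaugeIter.trueLinIter_smul U₀ Q hQ0 hQs (K - n) (r : ℂ) A.1 c]
        exact (RCLike.real_smul_eq_coe_smul (K := ℂ) r _).symm }
  -- the sublinear majorant `N Z = 2ε₀(L^{K−n})⁻¹·Σ_c‖Z c‖`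
  let N : (PBond (F.P K) (K - n) → Matrix (Fin 2) (Fin 2) ℂ) → ℝ := fun Z => 2 * ε₀ * ((F.L : ℝ) ^ (K - n))⁻¹ * ∑ c, ‖Z c‖
  have hC0 : 0 ≤ 2 * ε₀ * ((F.L : ℝ) ^ (K - n))⁻¹ := by positivity
  have N_hom : ∀ c : ℝ, 0 < c → ∀ x, N (c • x) = c * N x := by
    intro c hc x
    show 2 * ε₀ * ((F.L : ℝ) ^ (K - n))⁻¹ * ∑ c', ‖(c • x) c'‖ = c * (2 * ε₀ * ((F.L : ℝ) ^ (K - n))⁻¹ * ∑ c', ‖x c'‖)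
    simp only [Pi.smul_apply, norm_smul, Real.norm_eq_abs, abs_of_pos hc, ← Finset.mul_sum]
    ring
  have N_add : ∀ x y, N (x + y) ≤ N x + N y := by
    intro x y
    show 2 * ε₀ * ((F.L : ℝ) ^ (K - n))⁻¹ * ∑ c, ‖(x + y) c‖
      ≤ 2 * ε₀ * ((F.L : ℝ) ^ (K - n))⁻¹ * ∑ c, ‖x c‖ + 2 * ε₀ * ((F.L : ℝ) ^ (K - n))⁻¹ * ∑ c, ‖y c‖
    rw [← mul_add, ← Finset.sum_add_distrib]
    exact mul_le_mul_of_nonneg_left (Finset.sum_le_sum fun c _ => by rw [Pi.add_apply]; exact norm_add_le _ _) hC0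
  have N_neg : ∀ x, N (-x) = N x := by
    intro x
    show 2 * ε₀ * ((F.L : ℝ) ^ (K - n))⁻¹ * ∑ c, ‖(-x) c‖ = 2 * ε₀ * ((F.L : ℝ) ^ (K - n))⁻¹ * ∑ c, ‖x c‖
    simp only [Pi.neg_apply, norm_neg]
  -- domination `|L A| ≤ N (T A)` by §1 of the exact-pairing file
  have hdom : ∀ A : S, |L A| ≤ N (T A) := by
    intro A
    have h1 := abs_lin_le_sum_norm_trueLinIter F hnK hcrit hε₀ hε hU₀reg Q hQ0 hQs A.1 (fun b => (A.2 b).1) (fun b => (A.2 b).2)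
    rw [Prop7FirstVariationCurrent.lin_eq_neg_half_sum_re_trace_mul_covDivT] at h1
    exact h1
  obtain ⟨Λ, hΛ, hΛN⟩ := exists_factor_abs_le L T N N_hom N_add N_neg hdom
  refine ⟨Λ, fun A hA htr => ?_, fun ξ hξ hξt => ?_, fun Z => hΛN Z⟩
  · have h := hΛ ⟨A, fun b => ⟨hA b, htr b⟩⟩
    rw [Prop7FirstVariationCurrent.lin_eq_neg_half_sum_re_trace_mul_covDivT]
    exact h
  · obtain ⟨hα, _, haN⟩ := tower_loop_rows_of_regPr F hε₀ hε hU₀reg (K := K) (n := n)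
    -- the fine gauge direction of `ξ` is in `S`
    let Aξ : S := ⟨fun b : PBond (F.P K) 0 => ξ b.src - ((U₀ b : Matrix.specialUnitaryGroup (Fin 2) ℂ) : Matrix (Fin 2) (Fin 2) ℂ) * ξ b.tgt *
        star ((U₀ b : Matrix.specialUnitaryGroup (Fin 2) ℂ) : Matrix (Fin 2) (Fin 2) ℂ),
      fun b => gaugeDir_mem_su2 (hξ b.src) (hξt b.src) (hξ b.tgt) (hξt b.tgt) (U₀ b)⟩
    have hQξ := Prop7TrueLinPureGaugeIter.trueLinIter_pureGauge U₀ Q hQ0 hQs ξ (K - n)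
      (fun j hj c i => (hα j hj c i).trans_lt (haN j hj))
    have hT : T Aξ = fun c : PBond (F.P K) (K - n) => ξ (embIter (K - n) c.src)
          - ((Averaging.iter (fun i => blockAvg (P := F.P K) (j := i) (expMeanLogSU (n := Fin 2))) (K - n) U₀ c : Matrix.specialUnitaryGroup (Fin 2) ℂ) :
              Matrix (Fin 2) (Fin 2) ℂ) * ξ (embIter (K - n) c.tgt)
            * star ((Averaging.iter (fun i => blockAvg (P := F.P K) (j := i) (expMeanLogSU (n := Fin 2))) (K - n) U₀ c : Matrix.specialUnitaryGroup (Fin 2) ℂ) :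
              Matrix (Fin 2) (Fin 2) ℂ) := funext fun c => hQξ c
    have hL : L Aξ = 0 := by
      show -(1 / 2) * ∑ b : PBond (F.P K) 0, (((fun b : PBond (F.P K) 0 => ξ b.src - ((U₀ b : Matrix.specialUnitaryGroup (Fin 2) ℂ) : Matrix (Fin 2) (Fin 2) ℂ) * ξ b.tgt *
        star ((U₀ b : Matrix.specialUnitaryGroup (Fin 2) ℂ) : Matrix (Fin 2) (Fin 2) ℂ)) b * covDivT 1 (unitsField (toUField U₀)) b.dir b.src).trace).re = 0
      rw [← Prop7FirstVariationCurrent.lin_eq_neg_half_sum_re_trace_mul_covDivT]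
      exact Prop7LinGaugeInvariance.lin_gaugeDir_eq_zero U₀ ξ
    rw [← hT, ← hΛ Aξ, hL]

/-- ★ **THE MULTIPLIER FIELD (RIESZ REPRESENTATIVE) WITH ITS POINTWISE SIZE.**  Same binders: there is a coarse bond field `λ : T^{(K−n)}-bonds → M₂(ℂ)` — the Lagrange
multiplier of the (0.4)-constraint read through the trace pairing `⟨λ, Z⟩ = Σ_c Re tr(λ(c)Z(c))` — with (i) `Lin_{U₀}(A) = Σ_c Re tr(λ(c)·(Q (K−n) A)(c))` for every
`𝔰𝔲(2)`-valued `A`, (ii) `Σ_c Re tr(λ(c)·(ξ(c₋) − V_cξ(c₊)V_c*)) = 0` for every `𝔰𝔲(2)`-valued site field `ξ` (the multiplier field is orthogonal to every coarse pure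
gauge — its `𝔰𝔲(2)`-covariant divergence at `V` vanishes, weakly), (iii) `|Σ_c Re tr(λ(c)Z(c))| ≤ 2ε₀(L^{K−n})⁻¹·Σ_c‖Z c‖` for every `Z`, and (iv) the POINTWISE size
`‖λ(c)‖ ≤ 2ε₀(L^{K−n})⁻¹` at every coarse bond (§2). [cite: Balaban1985Variational, (141)-(143) p.299, (45)-(48) pp.285-287; Balaban1985BackgroundPropagators, (3.9)-(3.11) p.392] -/
theorem exists_multiplier_field (hnK : n ≤ K)
    {V : GaugeField (F.P n) 0 (Matrix.specialUnitaryGroup (Fin 2) ℂ)} {U₀ : GaugeField (F.P K) 0 (Matrix.specialUnitaryGroup (Fin 2) ℂ)}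
    (hcrit : IsCritR2 F n K hnK V U₀) {ε₀ : ℝ} (hε₀ : 0 < ε₀) (hε : 10 ^ 10 * (F.L : ℝ) ^ 6 * ε₀ ≤ 1) (hU₀reg : RegPr F n K ε₀ U₀)
    (Q : (k : ℕ) → (PBond (F.P K) 0 → Matrix (Fin 2) (Fin 2) ℂ) → PBond (F.P K) k → Matrix (Fin 2) (Fin 2) ℂ) (hQ0 : ∀ Y, Q 0 Y = Y)
    (hQs : ∀ (k : ℕ) (Y : PBond (F.P K) 0 → Matrix (Fin 2) (Fin 2) ℂ) (c : PBond (F.P K) (k + 1)), Q (k + 1) Y c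
      = fderiv ℂ (eml : (Idx (F.P K) → Matrix (Fin 2) (Fin 2) ℂ) → Matrix (Fin 2) (Fin 2) ℂ)
            (fun i => ((loopHol (Averaging.iter (fun i => blockAvg (P := F.P K) (j := i) (expMeanLogSU (n := Fin 2))) k U₀) c i :
              Matrix.specialUnitaryGroup (Fin 2) ℂ) : Matrix (Fin 2) (Fin 2) ℂ))
            (fun i => covWalkSum (Averaging.iter (fun i => blockAvg (P := F.P K) (j := i) (expMeanLogSU (n := Fin 2))) k U₀) (Q k Y)
                (walk (emb c.src) (loopWord (F.P K).L c.dir (off i.1) i.2.1 i.2.2))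
              * ((loopHol (Averaging.iter (fun i => blockAvg (P := F.P K) (j := i) (expMeanLogSU (n := Fin 2))) k U₀) c i :
                Matrix.specialUnitaryGroup (Fin 2) ℂ) : Matrix (Fin 2) (Fin 2) ℂ))
            * star ((corr (expMeanLogSU (n := Fin 2)) (Averaging.iter (fun i => blockAvg (P := F.P K) (j := i) (expMeanLogSU (n := Fin 2))) k U₀) c :
                Matrix.specialUnitaryGroup (Fin 2) ℂ) : Matrix (Fin 2) (Fin 2) ℂ)
          + ((corr (expMeanLogSU (n := Fin 2)) (Averaging.iter (fun i => blockAvg (P := F.P K) (j := i) (expMeanLogSU (n := Fin 2))) k U₀) c :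
                Matrix.specialUnitaryGroup (Fin 2) ℂ) : Matrix (Fin 2) (Fin 2) ℂ)
            * covWalkSum (Averaging.iter (fun i => blockAvg (P := F.P K) (j := i) (expMeanLogSU (n := Fin 2))) k U₀) (Q k Y)
                (walk (emb c.src) (List.replicate (F.P K).L (c.dir, true)))
            * star ((corr (expMeanLogSU (n := Fin 2)) (Averaging.iter (fun i => blockAvg (P := F.P K) (j := i) (expMeanLogSU (n := Fin 2))) k U₀) c :
                Matrix.specialUnitaryGroup (Fin 2) ℂ) : Matrix (Fin 2) (Fin 2) ℂ)) :
    ∃ lam : PBond (F.P K) (K - n) → Matrix (Fin 2) (Fin 2) ℂ,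
      (∀ A : PBond (F.P K) 0 → Matrix (Fin 2) (Fin 2) ℂ, (∀ b, A b ∈ skewAdjoint (Matrix (Fin 2) (Fin 2) ℂ)) → (∀ b, (A b).trace = 0) →
        ∑ p : Plaq (F.P K) 0, (1 / 2) * ((((((GaugeField.plaqHol U₀ p : Matrix.specialUnitaryGroup (Fin 2) ℂ) : Matrix (Fin 2) (Fin 2) ℂ)) - 1)ᴴ
          * ((A ⟨p.src, p.μ⟩
              + (U₀ ⟨p.src, p.μ⟩ : Matrix (Fin 2) (Fin 2) ℂ) * A ⟨p.src.shift p.μ, p.ν⟩ * star (U₀ ⟨p.src, p.μ⟩ : Matrix (Fin 2) (Fin 2) ℂ)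
              - ((U₀ ⟨p.src, p.μ⟩ * U₀ ⟨p.src.shift p.μ, p.ν⟩ * (U₀ ⟨p.src.shift p.ν, p.μ⟩)⁻¹ : Matrix.specialUnitaryGroup (Fin 2) ℂ) : Matrix (Fin 2) (Fin 2) ℂ)
                  * A ⟨p.src.shift p.ν, p.μ⟩
                  * star ((U₀ ⟨p.src, p.μ⟩ * U₀ ⟨p.src.shift p.μ, p.ν⟩ * (U₀ ⟨p.src.shift p.ν, p.μ⟩)⁻¹ : Matrix.specialUnitaryGroup (Fin 2) ℂ) : Matrix (Fin 2) (Fin 2) ℂ)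
              - ((GaugeField.plaqHol U₀ p : Matrix.specialUnitaryGroup (Fin 2) ℂ) : Matrix (Fin 2) (Fin 2) ℂ) * A ⟨p.src, p.ν⟩
                  * star ((GaugeField.plaqHol U₀ p : Matrix.specialUnitaryGroup (Fin 2) ℂ) : Matrix (Fin 2) (Fin 2) ℂ))
            * ((GaugeField.plaqHol U₀ p : Matrix.specialUnitaryGroup (Fin 2) ℂ) : Matrix (Fin 2) (Fin 2) ℂ))).trace).re = ∑ c, ((lam c * Q (K - n) A c).trace).re) ∧
      (∀ ξ : Site (F.P K) 0 → Matrix (Fin 2) (Fin 2) ℂ, (∀ x, ξ x ∈ skewAdjoint (Matrix (Fin 2) (Fin 2) ℂ)) → (∀ x, (ξ x).trace = 0) →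
        ∑ c : PBond (F.P K) (K - n), ((lam c * (ξ (embIter (K - n) c.src)
          - ((Averaging.iter (fun i => blockAvg (P := F.P K) (j := i) (expMeanLogSU (n := Fin 2))) (K - n) U₀ c : Matrix.specialUnitaryGroup (Fin 2) ℂ) :
              Matrix (Fin 2) (Fin 2) ℂ) * ξ (embIter (K - n) c.tgt)
            * star ((Averaging.iter (fun i => blockAvg (P := F.P K) (j := i) (expMeanLogSU (n := Fin 2))) (K - n) U₀ c : Matrix.specialUnitaryGroup (Fin 2) ℂ) :
              Matrix (Fin 2) (Fin 2) ℂ))).trace).re = 0) ∧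
      (∀ Z : PBond (F.P K) (K - n) → Matrix (Fin 2) (Fin 2) ℂ, |∑ c, ((lam c * Z c).trace).re| ≤ 2 * ε₀ * ((F.L : ℝ) ^ (K - n))⁻¹ * ∑ c, ‖Z c‖) ∧
      (∀ c : PBond (F.P K) (K - n), ‖lam c‖ ≤ 2 * ε₀ * ((F.L : ℝ) ^ (K - n))⁻¹) := by
  obtain ⟨Λ, h1, h2, h3⟩ := exists_multiplier_functional_bounded F hnK hcrit hε₀ hε hU₀reg Q hQ0 hQs
  obtain ⟨lam, hlam⟩ := exists_re_trace_pairing Λ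
  have h3' : ∀ Z : PBond (F.P K) (K - n) → Matrix (Fin 2) (Fin 2) ℂ, |∑ c, ((lam c * Z c).trace).re| ≤ 2 * ε₀ * ((F.L : ℝ) ^ (K - n))⁻¹ * ∑ c, ‖Z c‖ :=
    fun Z => by rw [← hlam Z]; exact h3 Z
  refine ⟨lam, fun A hA htr => ?_, fun ξ hξ hξt => ?_, h3', fun c => norm_le_of_abs_sum_re_trace_mul_le lam (by positivity) h3' c⟩
  · rw [← hlam]; exact h1 A hA htr
  · rw [← hlam]; exact h2 ξ hξ hξt

end Summit.QuantumFields.YangMills.Theorems.Prop7FirstVariationMultiplierBound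

end
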